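import Literature.AlgebraicGeometry.Motives.AlgPointsHolomorphicFamilies
import Literature.AlgebraicGeometry.Motives.AlgPointsProperProofs
import Literature.AlgebraicGeometry.Motives.AbelianVariety
import HarnessLib

/-!
# Holomorphic families of complex points: the affine criterion and products in group schemes

Companion of `Literature/AlgebraicGeometry/Motives/AlgPointsHolomorphicFamilies.lean`
(`AlgPoints.IsHolFamilyOn U G`: a family `G : P → X(ℂ)` on an open set `U` of a complex normed
space is interpolated by a `ℂ`-morphism `Spec (holomorphic functions on U) ⟶ X`). That file proves
the CONSEQUENCES of being a holomorphic family (continuity; regular functions pull back to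
holomorphic functions, Serre, GAGA §2 n°5 Lemme 1) and its stability under reparametrisation,
morphisms and pairs. This file proves the converse CRITERION on an affine open, which is how
holomorphic families are produced in practice, and the resulting closure properties in a
commutative group scheme:

* `AlgPoints.isHolFamilyOn_of_differentiableOn_evalOrZero` — **the affine criterion** (Serre,
  GAGA §2 n°5, p. 9: "une application `φ : U → V` d'un espace analytique dans une variété affine
  `V ⊂ ℂⁿ` est holomorphe si et seulement si les coordonnées `xᵢ ∘ φ` le sont"; here for
  `X(ℂ)`-valued families): if `G` maps `U` into the complex points `V(ℂ)` of ONE affine open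
  `V = Spec A ⊆ X` and every regular function `s ∈ A = Γ(X, V)` pulls back to a function
  `u ↦ s(G u)` complex differentiable on `U`, then `G` is a holomorphic family on `U`: the
  evaluation `s ↦ (u ↦ s(G u))` is a `ℂ`-algebra homomorphism `A → holFun U`
  (`AlgPoints.holEvalFamily`), and `Spec` of it, followed by `Spec A ⟶ X`, interpolates `G`
  (`AlgPoints.specMap_evalRingHom_fromSpec`, Hartshorne II Ex. 2.7 / Prop. 2.3).
* `IsHolFamilyOn.congr`, `IsHolFamilyOn.const` — bookkeeping.
* `IsHolFamilyOn.mul`, `.inv`, `.one`, `.finsetProd` — for a (commutative) group scheme `G` over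
  `ℂ`, pointwise products and inverses of holomorphic families in `G(ℂ)` (Mathlib's scoped group
  structure `Hom.group` / `Hom.commGroup` on `G(ℂ) = Hom_ℂ(Spec ℂ, G)`) are holomorphic families:
  `P · Q = μ ∘ (P, Q)` and `IsHolFamilyOn.prodMk` / `.map` (Mumford, *Abelian Varieties*, §1 (1):
  the group law of `A(ℂ)` is holomorphic; here in the algebraic form "`μ` is a morphism").

Everything is proved; no named facts.

## References

* J.-P. Serre, *Géométrie algébrique et géométrie analytique*, Ann. Inst. Fourier 6 (1956),
  §2 n°5 p. 9 (holomorphic maps into an affine variety are tested on coordinates). [SerreGAGA1956]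
* R. Hartshorne, *Algebraic Geometry*, GTM 52 (1977), II Ex. 2.7, Prop. 2.3 (points of `Spec A`
  with values in a ring). [Hartshorne1977]
* D. Mumford, *Abelian Varieties* (1970), §1 (1). [MumfordAV1970]
-/

noncomputable section

universe u

open CategoryTheory AlgebraicGeometry Topology MonoidalCategory CartesianMonoidalCategory
open scoped MonObj

namespace Literature.AlgebraicGeometry.Motives

/-! ### `Spec Γ(X, V) → X → Spec k` is `Spec` of the scalars -/

namespace SchemeOver

variable {k : Type u} [Field k] {X : SchemeOver k}

/-- For an affine open `V` of a `k`-scheme `X`, `Spec Γ(X, V) → X → Spec k` is `Spec` of the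
scalar map `k → Γ(X, V)` (Mathlib `IsAffineOpen.SpecMap_appLE_fromSpec`; Hartshorne II Ex. 2.4).
Same statement as `UniversalHyperplaneSection.fromSpec_comp_hom`, recorded here without the
projective-embedding context of that file. [folklore] -/
theorem fromSpec_comp_hom {V : X.left.Opens} (hV : IsAffineOpen V) :
    hV.fromSpec ≫ X.hom = Spec.map (CommRingCat.ofHom (scalarRingHom X V)) := by
  have h1 := IsAffineOpen.SpecMap_appLE_fromSpec X.hom (isAffineOpen_top _) hV
    (V := V) (U := ⊤) le_top
  rw [IsAffineOpen.fromSpec_top, Scheme.isoSpec_Spec_inv, ← Spec.map_comp] at h1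
  rw [← h1]
  rfl

end SchemeOver

namespace AlgPoints

variable {P : Type} [NormedAddCommGroup P] [NormedSpace ℂ P] {X Y : SchemeOver ℂ}

/-! ### The affine criterion -/

section Affine

variable {U : Set P} (V : X.left.Opens) (G : P → AlgPoints X ℂ)
  (hGV : ∀ u ∈ U, (G u).pt ∈ V)
  (hhol : ∀ s : Γ(X.left, V), DifferentiableOn ℂ (fun u ↦ evalOrZero V s (G u)) U)

/-- **Evaluation along a family** `G : P → X(ℂ)` mapping `U` into `V(ℂ)`, all of whose pulled
back regular functions are holomorphic on `U`: the `ℂ`-algebra homomorphism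
`Γ(X, V) → holFun U`, `s ↦ (u ↦ s(G u))` (for the scalar structure `k → Γ(X, V)`,
`SchemeOver.scalarRingHom`). [cite: SerreGAGA1956, §2 n°5 p. 9] -/
def holEvalFamily :
    letI := (SchemeOver.scalarRingHom X V).toAlgebra
    Γ(X.left, V) →ₐ[ℂ] holFun U :=
  letI := (SchemeOver.scalarRingHom X V).toAlgebra
  { toFun := fun s ↦ holFun.restrict (fun u ↦ evalOrZero V s (G u)) (hhol s)
    map_one' := Subtype.ext <| funext fun x ↦ by
      change evalOrZero V 1 (G x) = 1
      rw [evalOrZero_of_mem _ (hGV x x.2), ← evalRingHom_apply, map_one]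
    map_mul' := fun s t ↦ Subtype.ext <| funext fun x ↦ by
      change evalOrZero V (s * t) (G x) = evalOrZero V s (G x) * evalOrZero V t (G x)
      rw [evalOrZero_of_mem _ (hGV x x.2), evalOrZero_of_mem _ (hGV x x.2),
        evalOrZero_of_mem _ (hGV x x.2), ← evalRingHom_apply, ← evalRingHom_apply,
        ← evalRingHom_apply, map_mul]
    map_zero' := Subtype.ext <| funext fun x ↦ by
      change evalOrZero V 0 (G x) = 0
      rw [evalOrZero_of_mem _ (hGV x x.2), ← evalRingHom_apply, map_zero]
    map_add' := fun s t ↦ Subtype.ext <| funext fun x ↦ by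
      change evalOrZero V (s + t) (G x) = evalOrZero V s (G x) + evalOrZero V t (G x)
      rw [evalOrZero_of_mem _ (hGV x x.2), evalOrZero_of_mem _ (hGV x x.2),
        evalOrZero_of_mem _ (hGV x x.2), ← evalRingHom_apply, ← evalRingHom_apply,
        ← evalRingHom_apply, map_add]
    commutes' := fun c ↦ Subtype.ext <| funext fun x ↦ by
      change evalOrZero V (SchemeOver.scalarRingHom X V c) (G x) = c
      rw [evalOrZero_of_mem _ (hGV x x.2), eval_scalarRingHom]
      rfl }

/-- Values of `holEvalFamily`: `(holEvalFamily s)(x) = s(G x)`. [folklore] -/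
@[simp]
theorem holEvalFamily_apply (s : Γ(X.left, V)) (x : U) :
    letI := (SchemeOver.scalarRingHom X V).toAlgebra
    ((holEvalFamily V G hGV hhol s : holFun U) : U → ℂ) x = evalOrZero V s (G x) :=
  rfl

/-- Evaluation at `x ∈ U` after `holEvalFamily` is evaluation at the point `G x ∈ V(ℂ)`.
[folklore] -/
theorem holEval_comp_holEvalFamily (x : U) :
    letI := (SchemeOver.scalarRingHom X V).toAlgebra
    (holEval x).comp (holEvalFamily V G hGV hhol).toRingHom = (G x).evalRingHom V (hGV x x.2) := by
  letI := (SchemeOver.scalarRingHom X V).toAlgebra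
  refine RingHom.ext fun s ↦ ?_
  rw [RingHom.comp_apply, holEval_apply, evalRingHom_apply]
  change evalOrZero V s (G x) = _
  rw [evalOrZero_of_mem _ (hGV x x.2)]

include hGV hhol in
/-- **The affine criterion for holomorphic families** (Serre, GAGA §2 n°5 p. 9: a map into an
affine variety is holomorphic iff its coordinates are). If `G : P → X(ℂ)` maps `U` into the
complex points of an affine open `V = Spec A ⊆ X` and `u ↦ s(G u)` is complex differentiable on
`U` for every `s ∈ A = Γ(X, V)`, then `G` is a holomorphic family on `U`: it is interpolated by
`Spec (holFun U) → Spec A → X`, `Spec` of the evaluation homomorphism `holEvalFamily`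
(specialisation at `x` is the point `G x` by `AlgPoints.specMap_evalRingHom_fromSpec`,
Hartshorne II Ex. 2.7). [cite: SerreGAGA1956, §2 n°5 p. 9] -/
theorem isHolFamilyOn_of_differentiableOn_evalOrZero (hV : IsAffineOpen V) :
    IsHolFamilyOn U G := by
  letI := (SchemeOver.scalarRingHom X V).toAlgebra
  let φ : Γ(X.left, V) →ₐ[ℂ] holFun U := holEvalFamily V G hGV hhol
  refine ⟨Over.homMk (Spec.map (CommRingCat.ofHom φ.toRingHom) ≫ hV.fromSpec) ?_, fun x ↦ ?_⟩
  · change (Spec.map (CommRingCat.ofHom φ.toRingHom) ≫ hV.fromSpec) ≫ X.hom =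
      Spec.map (CommRingCat.ofHom (algebraMap ℂ (holFun U)))
    rw [Category.assoc, SchemeOver.fromSpec_comp_hom hV, ← Spec.map_comp,
      ← CommRingCat.ofHom_comp]
    exact congrArg (fun g ↦ Spec.map (CommRingCat.ofHom g)) φ.comp_algebraMap
  · apply Over.OverMorphism.ext
    change Spec.map (CommRingCat.ofHom (holEval x)) ≫
        Spec.map (CommRingCat.ofHom φ.toRingHom) ≫ hV.fromSpec = (G x).toSpecHom
    rw [← Spec.map_comp_assoc, ← CommRingCat.ofHom_comp, holEval_comp_holEvalFamily V G hGV hhol x]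
    exact specMap_evalRingHom_fromSpec (G x) hV (hGV x x.2)

end Affine

/-! ### Bookkeeping -/

section Basic

variable {U : Set P} {G G' : P → AlgPoints X ℂ}

/-- A holomorphic family only depends on its values on `U`. [folklore] -/
theorem IsHolFamilyOn.congr (h : IsHolFamilyOn U G) (heq : Set.EqOn G G' U) :
    IsHolFamilyOn U G' := by
  obtain ⟨σ, hσ⟩ := h
  exact ⟨σ, fun x ↦ (hσ x).trans (heq x.2)⟩

/-- **Constant families are holomorphic**: `Q ∈ X(ℂ)` is interpolated by
`Spec (holFun U) → Spec ℂ → X`. [folklore] -/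
theorem IsHolFamilyOn.const (U : Set P) (Q : AlgPoints X ℂ) : IsHolFamilyOn U fun _ ↦ Q := by
  refine ⟨specOverOfAlgHom (Algebra.ofId ℂ (holFun U)) ≫ Q, fun x ↦ ?_⟩
  rw [← Category.assoc, ← specOverOfAlgHom_comp]
  have h1 : (holEvalₐ x).comp (Algebra.ofId ℂ (holFun U)) = AlgHom.id ℂ ℂ :=
    AlgHom.ext fun c ↦ by rw [AlgHom.comp_apply, Algebra.ofId_apply, AlgHom.commutes]; rfl
  have h2 : specOverOfAlgHom (AlgHom.id ℂ ℂ) = 𝟙 (specOver ℂ ℂ) := by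
    apply Over.OverMorphism.ext
    rw [specOverOfAlgHom_left, Over.id_left]
    change Spec.map (CommRingCat.ofHom (RingHom.id ℂ)) = _
    rw [CommRingCat.ofHom_id]
    exact Spec.map_id _
  rw [h1, h2, Category.id_comp]

end Basic

/-! ### Products and inverses in a group scheme -/

section Group

variable {G : SchemeOver ℂ} [GrpObj G] {U : Set P} {G₁ G₂ : P → AlgPoints G ℂ}

/-- **Pointwise products of holomorphic families in a group scheme are holomorphic**:
`P · Q = μ(P, Q)` with `μ : G × G ⟶ G` the group law, so this is `IsHolFamilyOn.prodMk` followed by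
`IsHolFamilyOn.map μ` (Mumford, *Abelian Varieties*, §1 (1)). [cite: MumfordAV1970, §1 (1)] -/
theorem IsHolFamilyOn.mul (h₁ : IsHolFamilyOn U G₁) (h₂ : IsHolFamilyOn U G₂) :
    IsHolFamilyOn U fun x ↦ G₁ x * G₂ x := by
  have h : (fun x ↦ G₁ x * G₂ x) =
      fun x ↦ AlgPoints.map μ[G] ((prodEquiv (X := G) (Y := G) (L := ℂ)).symm (G₁ x, G₂ x)) := by
    funext x
    rfl
  rw [h]
  exact (h₁.prodMk h₂).map μ[G]

/-- **Pointwise inverses of holomorphic families are holomorphic**: `P⁻¹ = ι(P)`.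
[cite: MumfordAV1970, §1 (1)] -/
theorem IsHolFamilyOn.inv (h₁ : IsHolFamilyOn U G₁) : IsHolFamilyOn U fun x ↦ (G₁ x)⁻¹ :=
  h₁.map ι[G]

/-- The unit family is holomorphic. [folklore] -/
theorem IsHolFamilyOn.one (U : Set P) : IsHolFamilyOn U fun _ ↦ (1 : AlgPoints G ℂ) :=
  IsHolFamilyOn.const U 1

/-- **Finite pointwise products of holomorphic families in a commutative group scheme are
holomorphic.** [cite: MumfordAV1970, §1 (1)] -/
theorem IsHolFamilyOn.finsetProd [IsCommMonObj G] {J : Type*} (s : Finset J)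
    {F : J → P → AlgPoints G ℂ} (h : ∀ i ∈ s, IsHolFamilyOn U (F i)) :
    IsHolFamilyOn U fun x ↦ ∏ i ∈ s, F i x := by
  classical
  induction s using Finset.induction_on with
  | empty =>
    simp only [Finset.prod_empty]
    exact IsHolFamilyOn.one U
  | insert a s ha ih =>
    simp only [Finset.prod_insert ha]
    exact (h a (Finset.mem_insert_self a s)).mul
      (ih fun i hi ↦ h i (Finset.mem_insert_of_mem hi))

end Group

end AlgPoints

end Literature.AlgebraicGeometry.Motives

end
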